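import Mathlib
import Summits.NavierStokesRegularity.OSWSelfSimilar.SheetNSLineTorusCascadeThreshold
import Summits.NavierStokesRegularity.OSWSelfSimilar.SheetNSLineTorusCascadeThresholdOpen
import HarnessLib

/-!
# Viscous CLM on the torus (`a = 0`, `σ = 2`): `κ*` IS EXACTLY THE WIENER THRESHOLD OF THE SINE DATUM, AND IT IS NOT
# ATTAINED — the strict window lemma under a Wiener hypothesis

HONEST FRAMING (cell ns-blowup GROUP B «PROFILE SEARCH», zone Z3, row Z3-U addendum A-F2 of `HOME/profile/z3/CENSUS-Z3.md`;
human rulings D-0035/D-0074; Z3-TWIN lineage, eng-5 g15): **1-D MODEL (viscous Constantin–Lax–Majda equation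
`ω_t = ω Hω + ν ω_xx` on `𝕋`); real analysis on the Fourier cascade, kernel-checked; not Euler, not Navier–Stokes; «violates: none —
MODEL».**

OBJECTS (from the tree): the universal family `E := cascadeSolution 1 (sineDatum 1)` and its amplitude scalings `κ^k E_k`
(`isSineCascade_smul_universal`); `thresholdSet`, `criticalConstant = κ*` and the «no delayed blow-up» window lemma
`le_criticalConstant_of_window` (`SheetNSLineTorusCascadeThreshold`, eng-5 g14); the openness estimate
`IsNonnegCascade.partialSum_smul_le` (`SheetNSLineTorusCascadeThresholdOpen`). «Galerkin sums» = `Σ_{k≤K} κ^k E_k(τ)`. No definitions.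

THEOREMS (`κ ≥ 0`).
* `partialSum_le_of_partialSum_le` — **OPENNESS OF THE WINDOW-WIENER SET**: a Galerkin bound `B` at `κ > 0` on `[0, L]` gives the
  Galerkin bound `B + 2δe^{BL}` at `κ + δ` on `[0, L]` (`δ > 0`, `δ(e^{BL} − 1) ≤ B`);
* **`lt_criticalConstant_of_partialSum_le` — THE STRICT WINDOW LEMMA UNDER A WIENER HYPOTHESIS**: Galerkin sums bounded on `[0, L]`
  with `log(κ/8) < L` force `κ < κ*` (openness at some `κ + δ` with `log((κ+δ)/8) ≤ L`, then g14's `le_criticalConstant_of_window`);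
* `exists_partialSum_le_of_lt_criticalConstant` — every `κ < κ*` has Galerkin sums bounded uniformly in `K` and `τ ≥ 0` (geometric
  domination from a member of `thresholdSet` above `κ`); `mem_thresholdSet_of_partialSum_le` (Wiener set ⊆ `thresholdSet`);
* **`partialSum_bounded_iff_lt_criticalConstant`: for `κ ≥ 0`, `(∃ B, ∀ K, ∀ τ ≥ 0, Σ_{k≤K} κ^k E_k(τ) ≤ B) ↔ κ < κ*`** — `κ*` IS the
  Wiener threshold and the Wiener set is `[0, κ*)`, OPEN at the top; `not_partialSum_bounded_criticalConstant` — AT `κ*` the Galerkin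
  sums are unbounded already on every window `[0, L]`, `L > log(κ*/8)`;
* two lemmas for the PDE sequel: `partialSum_cascadeSolution_sine_zero_le` (the sine datum's Galerkin sums are `≤ c`) and the
  **two-step bootstrap** `partialSum_le_of_rhs_bound` (a nonnegative lower-triangular sequence with `a_k ≤ A` and
  `νk² a_k ≤ P + ½ Σ_{i+j=k} a_i a_j` has `Σ_{k≤K} a_k ≤ 2(P + 2C₁²)/ν`, `C₁ = (P + A²)/ν`).

bears_on: LADDER-NS N5 / zone Z3 (row Z3-U, A-F2 (t1) datum-free tier, dichotomy form) → N1 linear core. WHAT THIS IS NOT: not NS; no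
PDE object in this file (the sequel `…ThresholdCritical`); whether `κ* ∈ thresholdSet` (TERMWISE `ℓ^∞` boundedness AT criticality)
is NOT decided — only the Wiener (`ℓ¹`) threshold is; no digit of `κ*` beyond the tree's `[19.76, 19.83]`.
-/

noncomputable section

namespace Summit.NavierStokesRegularity.OSWSelfSimilar
namespace SheetNSLineTorusCascade

open Finset Real Set Filter
open scoped Topology

/-! ### The universal family: openness and the exact Wiener threshold -/

/-- The scaled universal family `κ^k E_k` is a nonnegative cascade at `ν = 1` (`κ ≥ 0`). -/
theorem isNonnegCascade_smul_universal {κ : ℝ} (hκ : 0 ≤ κ) :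
    IsNonnegCascade 1 (fun k t => κ ^ k * cascadeSolution 1 (sineDatum 1) k t) :=
  (isSineCascade_smul_universal κ).isNonnegCascade hκ

/-- A weighted Galerkin sum of the scaled universal family AT `τ = 0` is its mode-`1` term: `Σ_{k≤K} w_k κ^k E_k(0) = w_1 κ`
(`K ≥ 1`; the datum is the single mode `E_1(0) = 1`). [new here — MODEL] -/
theorem sum_weight_smul_universal_zero (w : ℕ → ℝ) (κ : ℝ) {K : ℕ} (hK : 1 ≤ K) :
    ∑ k ∈ range (K + 1), w k * (κ ^ k * cascadeSolution 1 (sineDatum 1) k 0) = w 1 * κ := by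
  have hs := isSineCascade_smul_universal κ
  rw [Finset.sum_eq_single_of_mem 1 (mem_range.mpr (by omega)) ?_]
  · exact congrArg (w 1 * ·) hs.one_init
  · intro k _ hk1
    rcases Nat.lt_or_ge k 2 with hk | hk
    · interval_cases k
      · exact by rw [hs.zero 0, mul_zero]
      · exact absurd rfl hk1
    · rw [hs.init_zero k hk, mul_zero]

/-- The weighted Galerkin sums at `τ = 0` are at most `w_1 κ` when `w_1 κ ≥ 0` (all `K`). -/
theorem sum_weight_smul_universal_zero_le (w : ℕ → ℝ) (κ : ℝ) (h1 : 0 ≤ w 1 * κ) (K : ℕ) :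
    ∑ k ∈ range (K + 1), w k * (κ ^ k * cascadeSolution 1 (sineDatum 1) k 0) ≤ w 1 * κ := by
  rcases Nat.eq_zero_or_pos K with hK | hK
  · subst hK
    rw [sum_range_succ, sum_range_zero, (isSineCascade_smul_universal κ).zero 0, mul_zero, zero_add]
    exact h1
  · exact (sum_weight_smul_universal_zero w κ hK).le

/-- **OPENNESS OF THE WINDOW-WIENER SET.** If the Galerkin sums of the amplitude-`κ` universal family are bounded by `B` on
`[0, L]` (`κ > 0`), then for every `δ > 0` with `δ (e^{BL} − 1) ≤ B` the Galerkin sums at amplitude `κ + δ` are bounded by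
`B + 2δ e^{BL}` on the same window. [new here — MODEL] -/
theorem partialSum_le_of_partialSum_le {κ B L δ : ℝ} (hκ : 0 < κ) (hδ : 0 < δ)
    (hB : ∀ K : ℕ, ∀ τ ∈ Icc (0 : ℝ) L, ∑ k ∈ range (K + 1), κ ^ k * cascadeSolution 1 (sineDatum 1) k τ ≤ B)
    (hsmall : δ * (Real.exp (B * L) - 1) ≤ B) :
    ∀ K : ℕ, ∀ τ ∈ Icc (0 : ℝ) L,
      ∑ k ∈ range (K + 1), (κ + δ) ^ k * cascadeSolution 1 (sineDatum 1) k τ ≤ B + 2 * δ * Real.exp (B * L) := by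
  intro K τ hτ
  have he := isNonnegCascade_smul_universal hκ.le
  set ρ : ℝ := (κ + δ) / κ with hρdef
  have hρ : 1 < ρ := by rw [hρdef, lt_div_iff₀ hκ]; linarith
  have hρκ : ρ * κ = κ + δ := by rw [hρdef]; field_simp
  have h1 : 0 < (fun k t => κ ^ k * cascadeSolution 1 (sineDatum 1) k t) 1 0 := by
    have := (isSineCascade_smul_universal κ).one_init
    simp only at this ⊢
    rw [this]; exact hκ
  have hinit : ∀ K : ℕ, ∑ k ∈ range (K + 1), (ρ ^ k - 1) * (κ ^ k * cascadeSolution 1 (sineDatum 1) k 0) ≤ δ := by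
    intro K
    have hw : 0 ≤ (ρ ^ 1 - 1) * κ := mul_nonneg (by rw [pow_one]; linarith) hκ.le
    refine (sum_weight_smul_universal_zero_le (fun k => ρ ^ k - 1) κ hw K).trans (le_of_eq ?_)
    rw [pow_one, sub_mul, hρκ]; ring
  have h := he.partialSum_smul_le zero_le_one h1 hρ hδ hB hinit hsmall K hτ
  refine le_of_eq_of_le ?_ h
  refine sum_congr rfl fun k _ => ?_
  rw [← mul_assoc, ← mul_pow, hρκ]

/-- Termwise bounds from Galerkin-sum bounds (nonnegative terms). -/
theorem smul_universal_le_of_partialSum_le {κ B : ℝ} (hκ : 0 ≤ κ) {s : Set ℝ} (hs : s ⊆ Ici 0)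
    (hB : ∀ K : ℕ, ∀ τ ∈ s, ∑ k ∈ range (K + 1), κ ^ k * cascadeSolution 1 (sineDatum 1) k τ ≤ B)
    (k : ℕ) {τ : ℝ} (hτ : τ ∈ s) : κ ^ k * cascadeSolution 1 (sineDatum 1) k τ ≤ B := by
  have hτ0 : 0 ≤ τ := hs hτ
  refine le_trans ?_ (hB k τ hτ)
  exact single_le_sum (f := fun j => κ ^ j * cascadeSolution 1 (sineDatum 1) j τ)
    (fun j _ => mul_nonneg (pow_nonneg hκ j) (universal_nonneg j hτ0)) (mem_range.mpr (Nat.lt_succ_self k))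

/-- A Galerkin-sum bound on `τ ≥ 0` puts `κ` into `thresholdSet` (the Wiener set sits inside the termwise set). -/
theorem mem_thresholdSet_of_partialSum_le {κ B : ℝ} (hκ : 0 ≤ κ)
    (hB : ∀ K : ℕ, ∀ τ : ℝ, 0 ≤ τ → ∑ k ∈ range (K + 1), κ ^ k * cascadeSolution 1 (sineDatum 1) k τ ≤ B) :
    κ ∈ thresholdSet :=
  ⟨hκ, B, fun k _ hτ => smul_universal_le_of_partialSum_le hκ (s := Ici 0) le_rfl (fun K τ hτ => hB K τ hτ) k hτ⟩

/-- **THE STRICT WINDOW LEMMA UNDER A WIENER HYPOTHESIS.** If the Galerkin sums at amplitude `κ ≥ 0` are bounded on `[0, L]`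
with `log(κ/8) < L`, then **`κ < κ*`** (openness gives a Galerkin — hence termwise — bound at some `κ + δ` whose pole-clearing
time `log((κ+δ)/8)` is still `≤ L`; g14's `le_criticalConstant_of_window` gives `κ + δ ≤ κ*`). [new here — MODEL] -/
theorem lt_criticalConstant_of_partialSum_le {κ B L : ℝ} (hκ : 0 ≤ κ)
    (hB : ∀ K : ℕ, ∀ τ ∈ Icc (0 : ℝ) L, ∑ k ∈ range (K + 1), κ ^ k * cascadeSolution 1 (sineDatum 1) k τ ≤ B)
    (hL : Real.log (κ / 8) < L) : κ < criticalConstant := by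
  rcases hκ.eq_or_lt with hκ0 | hκ0
  · rw [← hκ0]; exact criticalConstant_pos
  -- enlarge the bound to a positive one
  set B' : ℝ := max B 1 with hB'def
  have hB'0 : 0 < B' := lt_of_lt_of_le one_pos (le_max_right _ _)
  have hB' : ∀ K : ℕ, ∀ τ ∈ Icc (0 : ℝ) L,
      ∑ k ∈ range (K + 1), κ ^ k * cascadeSolution 1 (sineDatum 1) k τ ≤ B' :=
    fun K τ hτ => (hB K τ hτ).trans (le_max_left _ _)
  -- room above `κ` inside the window: `κ < 8 e^L`
  have hroom : κ < 8 * Real.exp L := by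
    have : κ / 8 < Real.exp L := (Real.log_lt_iff_lt_exp (by positivity)).mp hL
    linarith
  -- choose `δ`
  set δ : ℝ := min (B' / Real.exp (B' * L)) (8 * Real.exp L - κ) with hδdef
  have hδpos : 0 < δ := lt_min (div_pos hB'0 (exp_pos _)) (by linarith)
  have hsmall : δ * (Real.exp (B' * L) - 1) ≤ B' := by
    have h1 : δ ≤ B' / Real.exp (B' * L) := min_le_left _ _
    have hE : 0 < Real.exp (B' * L) := exp_pos _
    calc δ * (Real.exp (B' * L) - 1) ≤ δ * Real.exp (B' * L) :=
          mul_le_mul_of_nonneg_left (by linarith) hδpos.le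
      _ ≤ B' / Real.exp (B' * L) * Real.exp (B' * L) := mul_le_mul_of_nonneg_right h1 hE.le
      _ = B' := div_mul_cancel₀ B' hE.ne'
  have hwin : Real.log ((κ + δ) / 8) ≤ L := by
    have h2 : δ ≤ 8 * Real.exp L - κ := min_le_right _ _
    rw [Real.log_le_iff_le_exp (by positivity)]
    linarith
  -- Galerkin bound at `κ + δ` on `[0, L]`, hence termwise on the window `[0, log((κ+δ)/8)]`
  have hgal := partialSum_le_of_partialSum_le hκ0 hδpos hB' hsmall
  have hterm : ∀ k : ℕ, ∀ τ ∈ Icc (0 : ℝ) (Real.log ((κ + δ) / 8)),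
      (κ + δ) ^ k * cascadeSolution 1 (sineDatum 1) k τ ≤ B' + 2 * δ * Real.exp (B' * L) := by
    intro k τ hτ
    exact smul_universal_le_of_partialSum_le (by linarith) (s := Icc 0 L) (fun x hx => hx.1) hgal k
      ⟨hτ.1, hτ.2.trans hwin⟩
  have hle := le_criticalConstant_of_window hterm
  linarith

/-- **Below `κ*` the Galerkin sums are bounded uniformly in `K` and `τ ≥ 0`** (a member `κ₁ ∈ thresholdSet` above `κ` dominates
termwise by `C`, and `Σ (κ/κ₁)^k ≤ (1 − κ/κ₁)⁻¹`). [new here — MODEL] -/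
theorem exists_partialSum_le_of_lt_criticalConstant {κ : ℝ} (hκ : 0 ≤ κ) (hlt : κ < criticalConstant) :
    ∃ B : ℝ, ∀ K : ℕ, ∀ τ : ℝ, 0 ≤ τ →
      ∑ k ∈ range (K + 1), κ ^ k * cascadeSolution 1 (sineDatum 1) k τ ≤ B := by
  obtain ⟨κ₁, hκ₁, hlt₁⟩ := exists_mem_thresholdSet_of_lt hlt
  obtain ⟨-, C, hC⟩ := hκ₁
  have hκ₁pos : 0 < κ₁ := lt_of_le_of_lt hκ hlt₁
  have hC0 : 0 ≤ C := thresholdSet_const_nonneg hC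
  set q : ℝ := κ / κ₁ with hq
  have hq0 : 0 ≤ q := div_nonneg hκ hκ₁pos.le
  have hq1 : q < 1 := (div_lt_one hκ₁pos).mpr hlt₁
  refine ⟨C * (1 - q)⁻¹, fun K τ hτ => ?_⟩
  have hterm : ∀ k ∈ range (K + 1), κ ^ k * cascadeSolution 1 (sineDatum 1) k τ ≤ C * q ^ k := by
    intro k _
    have hid : κ ^ k * cascadeSolution 1 (sineDatum 1) k τ = q ^ k * (κ₁ ^ k * cascadeSolution 1 (sineDatum 1) k τ) := by
      rw [hq, div_pow, ← mul_assoc, div_mul_cancel₀ _ (pow_ne_zero k hκ₁pos.ne')]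
    rw [hid, mul_comm C]
    exact mul_le_mul_of_nonneg_left (hC k τ hτ) (pow_nonneg hq0 k)
  calc ∑ k ∈ range (K + 1), κ ^ k * cascadeSolution 1 (sineDatum 1) k τ
      ≤ ∑ k ∈ range (K + 1), C * q ^ k := sum_le_sum hterm
    _ = C * ∑ k ∈ range (K + 1), q ^ k := by rw [mul_sum]
    _ ≤ C * (1 - q)⁻¹ := by
        refine mul_le_mul_of_nonneg_left ?_ hC0
        have hs := summable_geometric_of_lt_one hq0 hq1
        calc ∑ k ∈ range (K + 1), q ^ k ≤ ∑' k, q ^ k :=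
              hs.sum_le_tsum (range (K + 1)) (fun k _ => pow_nonneg hq0 k)
          _ = (1 - q)⁻¹ := tsum_geometric_of_lt_one hq0 hq1

/-- **At and above `κ*` no window-Wiener bound survives past the pole-clearing time**: for `κ* ≤ κ` and `L > log(κ/8)` the
Galerkin sums at amplitude `κ` are NOT bounded on `[0, L]`. [new here — MODEL] -/
theorem not_partialSum_bounded_of_criticalConstant_le {κ L : ℝ} (hle : criticalConstant ≤ κ)
    (hL : Real.log (κ / 8) < L) :
    ¬ ∃ B : ℝ, ∀ K : ℕ, ∀ τ ∈ Icc (0 : ℝ) L,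
      ∑ k ∈ range (K + 1), κ ^ k * cascadeSolution 1 (sineDatum 1) k τ ≤ B := by
  rintro ⟨B, hB⟩
  have hκ : 0 ≤ κ := criticalConstant_nonneg.trans hle
  exact absurd (lt_criticalConstant_of_partialSum_le hκ hB hL) (not_lt.mpr hle)

/-- **AT THE CRITICAL CONSTANT the Galerkin sums are unbounded on every window `[0, L]`, `L > log(κ*/8)`** — the Wiener
threshold is not attained. [new here — MODEL] -/
theorem not_partialSum_bounded_criticalConstant {L : ℝ} (hL : Real.log (criticalConstant / 8) < L) :
    ¬ ∃ B : ℝ, ∀ K : ℕ, ∀ τ ∈ Icc (0 : ℝ) L,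
      ∑ k ∈ range (K + 1), criticalConstant ^ k * cascadeSolution 1 (sineDatum 1) k τ ≤ B :=
  not_partialSum_bounded_of_criticalConstant_le le_rfl hL

/-- **`κ*` IS THE WIENER THRESHOLD OF THE SINE DATUM, AND IT IS NOT ATTAINED.** For `κ ≥ 0`: the Galerkin sums
`Σ_{k≤K} κ^k E_k(τ)` are bounded uniformly in `K ∈ ℕ` and `τ ≥ 0` **iff `κ < κ*`**. (So the Wiener set is `[0, κ*)`, open at the
top, while `thresholdSet ∈ {[0, κ*), [0, κ*]}` stays undecided.) [new here — MODEL] -/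
theorem partialSum_bounded_iff_lt_criticalConstant {κ : ℝ} (hκ : 0 ≤ κ) :
    (∃ B : ℝ, ∀ K : ℕ, ∀ τ : ℝ, 0 ≤ τ →
        ∑ k ∈ range (K + 1), κ ^ k * cascadeSolution 1 (sineDatum 1) k τ ≤ B) ↔ κ < criticalConstant := by
  refine ⟨fun ⟨B, hB⟩ => ?_, exists_partialSum_le_of_lt_criticalConstant hκ⟩
  have hL : Real.log (κ / 8) < Real.log (κ / 8) + 1 := by linarith
  exact lt_criticalConstant_of_partialSum_le hκ (L := Real.log (κ / 8) + 1) (B := B)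
    (fun K τ hτ => hB K τ hτ.1) hL

/-! ### Two lemmas for the PDE sequel: the sine datum's Galerkin sums, and the two-step bootstrap -/

/-- The Galerkin sums of the explicit sine cascade at `t = 0` are at most `c` (`c ≥ 0`; the datum is the single mode `c_1 = c`). -/
theorem partialSum_cascadeSolution_sine_zero_le (ν : ℝ) {c : ℝ} (hc : 0 ≤ c) (K : ℕ) :
    ∑ k ∈ range (K + 1), cascadeSolution ν (sineDatum c) k 0 ≤ c := by
  have hs := isSineCascade_cascadeSolution ν c
  rcases Nat.eq_zero_or_pos K with hK | hK
  · subst hK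
    rw [sum_range_succ, sum_range_zero, zero_add, hs.zero 0]
    exact hc
  · rw [Finset.sum_eq_single_of_mem 1 (mem_range.mpr (by omega)) ?_]
    · rw [hs.one_init]
    · intro k _ hk1
      rcases Nat.lt_or_ge k 2 with hk | hk
      · interval_cases k
        · exact hs.zero 0
        · exact absurd rfl hk1
      · exact hs.init_zero k hk

/-- **Two-step bootstrap.** A nonnegative sequence with `a_0 = 0`, `a_k ≤ A` and
`ν k² a_k ≤ P + ½ Σ_{i+j=k} a_i a_j` (`k ≥ 1`, `ν > 0`, `P, A ≥ 0`) has `Σ_{k≤K} a_k ≤ 2(P + 2C₁²)/ν` for every `K`,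
`C₁ = (P + A²)/ν` (first `a_k ≤ C₁/k`, then `a_k ≤ (P + 2C₁²)/(νk²)` via `ij ≥ k/2` on `i + j = k`, then `Σ 1/k² ≤ 2`).
[new here — MODEL] -/
theorem partialSum_le_of_rhs_bound {a : ℕ → ℝ} {ν P A : ℝ} (hν : 0 < ν) (hP : 0 ≤ P) (hA : 0 ≤ A)
    (h0 : a 0 = 0) (hnn : ∀ k, 0 ≤ a k) (hbd : ∀ k, a k ≤ A)
    (hrhs : ∀ k : ℕ, 1 ≤ k → ν * (k : ℝ) ^ 2 * a k ≤ P + (1 / 2) * ∑ p ∈ antidiagonal k, a p.1 * a p.2)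
    (K : ℕ) : ∑ k ∈ range (K + 1), a k ≤ 2 * ((P + 2 * ((P + A ^ 2) / ν) ^ 2) / ν) := by
  set C₁ : ℝ := (P + A ^ 2) / ν with hC₁
  set C₂ : ℝ := (P + 2 * C₁ ^ 2) / ν with hC₂
  have hC₁0 : 0 ≤ C₁ := by positivity
  have hC₂0 : 0 ≤ C₂ := by positivity
  -- step 1: `a_k ≤ C₁ / k`
  have h1 : ∀ k : ℕ, 1 ≤ k → a k ≤ C₁ / k := by
    intro k hk
    have hk' : (1 : ℝ) ≤ k := by exact_mod_cast hk
    have hkpos : (0 : ℝ) < k := by linarith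
    have hconv : ∑ p ∈ antidiagonal k, a p.1 * a p.2 ≤ ((k : ℝ) + 1) * A ^ 2 := by
      calc ∑ p ∈ antidiagonal k, a p.1 * a p.2 ≤ ∑ p ∈ antidiagonal k, A ^ 2 :=
            sum_le_sum fun p _ => by rw [sq]; exact mul_le_mul (hbd _) (hbd _) (hnn _) hA
        _ = ((k : ℝ) + 1) * A ^ 2 := by
            rw [sum_const, Finset.Nat.card_antidiagonal, nsmul_eq_mul]; push_cast; ring
    have h := hrhs k hk
    have hA2 : ((k : ℝ) + 1) * A ^ 2 ≤ 2 * (k : ℝ) * A ^ 2 := by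
      have := mul_nonneg (sub_nonneg.mpr hk') (sq_nonneg A)
      linarith
    have hPk : P ≤ P * k := by
      have := mul_nonneg hP (sub_nonneg.mpr hk')
      linarith
    have h2 : ν * (k : ℝ) ^ 2 * a k ≤ (P + A ^ 2) * k := by linarith
    have h3 : ν * (k : ℝ) * a k ≤ P + A ^ 2 :=
      le_of_mul_le_mul_left (by linarith : (k : ℝ) * (ν * k * a k) ≤ k * (P + A ^ 2)) hkpos
    rw [le_div_iff₀ hkpos, hC₁, le_div_iff₀ hν]
    linarith
  -- step 2: the convolution is bounded, `Σ_{i+j=k} a_i a_j ≤ 4 C₁²`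
  have h2 : ∀ k : ℕ, 1 ≤ k → ∑ p ∈ antidiagonal k, a p.1 * a p.2 ≤ 4 * C₁ ^ 2 := by
    intro k hk
    have hk' : (1 : ℝ) ≤ k := by exact_mod_cast hk
    have hkpos : (0 : ℝ) < k := by linarith
    have hterm : ∀ p ∈ antidiagonal k, a p.1 * a p.2 ≤ 2 * C₁ ^ 2 / k := by
      intro p hp
      have hsum : p.1 + p.2 = k := mem_antidiagonal.mp hp
      rcases Nat.eq_zero_or_pos p.1 with hp1 | hp1
      · rw [hp1, h0, zero_mul]; positivity
      rcases Nat.eq_zero_or_pos p.2 with hp2 | hp2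
      · rw [hp2, h0, mul_zero]; positivity
      have hb1 := h1 p.1 hp1
      have hb2 := h1 p.2 hp2
      have hp1' : (1 : ℝ) ≤ p.1 := by exact_mod_cast hp1
      have hp2' : (1 : ℝ) ≤ p.2 := by exact_mod_cast hp2
      have hk2 : (k : ℝ) = p.1 + p.2 := by rw [← hsum]; push_cast; ring
      have hprod : (k : ℝ) / 2 ≤ (p.1 : ℝ) * p.2 := by
        have := mul_nonneg (sub_nonneg.mpr hp1') (sub_nonneg.mpr hp2')
        nlinarith
      calc a p.1 * a p.2 ≤ (C₁ / p.1) * (C₁ / p.2) := mul_le_mul hb1 hb2 (hnn _) (by positivity)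
        _ = C₁ ^ 2 / ((p.1 : ℝ) * p.2) := by rw [div_mul_div_comm, sq]
        _ ≤ C₁ ^ 2 / ((k : ℝ) / 2) := div_le_div_of_nonneg_left (by positivity) (by positivity) hprod
        _ = 2 * C₁ ^ 2 / k := by rw [div_div_eq_mul_div]; ring
    calc ∑ p ∈ antidiagonal k, a p.1 * a p.2 ≤ ∑ p ∈ antidiagonal k, 2 * C₁ ^ 2 / k := sum_le_sum hterm
      _ = ((k : ℝ) + 1) * (2 * C₁ ^ 2 / k) := by
          rw [sum_const, Finset.Nat.card_antidiagonal, nsmul_eq_mul]; push_cast; ring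
      _ = 2 * C₁ ^ 2 + 2 * C₁ ^ 2 / k := by field_simp
      _ ≤ 4 * C₁ ^ 2 := by
          have : 2 * C₁ ^ 2 / k ≤ 2 * C₁ ^ 2 := div_le_self (by positivity) hk'
          linarith
  -- step 3: `a_k ≤ C₂ / k²`
  have h3 : ∀ k : ℕ, 1 ≤ k → a k ≤ C₂ / (k : ℝ) ^ 2 := by
    intro k hk
    have hk' : (1 : ℝ) ≤ k := by exact_mod_cast hk
    have hkpos : (0 : ℝ) < k := by linarith
    have h := hrhs k hk
    have hc := h2 k hk
    rw [hC₂, div_div, le_div_iff₀ (by positivity)]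
    linarith
  -- step 4: sum, `Σ_{1 ≤ k ≤ K} 1/k² ≤ 2`
  have hsplit : ∑ k ∈ range (K + 1), a k = a 0 + ∑ k ∈ Ioo 0 (K + 1), a k := by
    rw [Finset.range_eq_Ico, ← Finset.Ioo_insert_left (Nat.succ_pos K), Finset.sum_insert (by simp)]
  rw [hsplit, h0, zero_add]
  calc ∑ k ∈ Ioo 0 (K + 1), a k ≤ ∑ k ∈ Ioo 0 (K + 1), C₂ * ((k : ℝ) ^ 2)⁻¹ := by
        refine sum_le_sum fun k hk => ?_
        rw [← div_eq_mul_inv]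
        exact h3 k (Finset.mem_Ioo.mp hk).1
    _ = C₂ * ∑ k ∈ Ioo 0 (K + 1), ((k : ℝ) ^ 2)⁻¹ := by rw [mul_sum]
    _ ≤ C₂ * 2 := by
        refine mul_le_mul_of_nonneg_left ?_ hC₂0
        have := sum_Ioo_inv_sq_le (α := ℝ) 0 (K + 1)
        simpa using this
    _ = 2 * ((P + 2 * C₁ ^ 2) / ν) := by rw [hC₂]; ring

end SheetNSLineTorusCascade
end Summit.NavierStokesRegularity.OSWSelfSimilar
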